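import Literature.Probability.Percolation.DecisionTreeBK
import HarnessLib

/-!
# Decision trees with per-node `S` / `S̄` decisions (Gladkov 2024, Def. 2.4 in full) and the bijection form of Lemma 3.1

Source: N. Gladkov, *Percolation Inequalities and Decision Trees*, arXiv:2408.08457 (2024) [Gladkov2024], §2
(Def. 2.3, **Def. 2.4**, Algorithm 1, pp. 3–4) and §3 (**Lemma 3.1** = [GZ24, Lemma 4.2], p. 4).

`DecisionTreeBK.lean` transcribes the SUB-class of Def. 2.4 in which every queried coordinate is sent to `S` (`DTree`,
`revealed`) — all that Thm. 4.3 and §6 use.  The printed definition is more general: "Let `T` be a decision tree, where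
each node selects an edge, decides whether this edge goes to the set `S` or `S̄` and reveals it in both `C₁` and `C₂`. In
this case, we say that the set `S = S(C₁, C₂)` is built by `T`" (Def. 2.4, with the standing condition "the nodes on every
path from `N₀` should query pairwise distinct edges"), and Lemma 3.1 holds for it: "Let `G` be finite. Let `S(C₁, C₂)` be
built by some decision tree. Then `C₁ →_S C₂` is independent of `C₂ →_S C₁ = C₁ →_S̄ C₂` and both are distributed as `μ`."

This file gives the finitary one-configuration form (the tree reads the first configuration; the second configuration is
its complement inside a finite ground set `D` — the "per-class" counting world of Gladkov's §3, in which Lemma 3.1 says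
that the hybrid map is a bijection of `𝒫(D)`):
* `MTree ι` — trees whose nodes carry the queried coordinate AND the decision (`true` = "to `S`", `false` = "to `S̄`");
  `MTree.kept T X` — the set `S(X)` built on the configuration `X` (the coordinates queried along the path of `X` at nodes
  deciding `S`); `MTree.ValidOn T seen` — no path of `T` queries a coordinate of `seen` or queries a coordinate twice
  (the printed standing condition, with an accumulator);
* `MTree.injOn_hybrid` — **Lemma 3.1, bijection form**: for a valid tree the hybrid map `X ↦ X →_{S(X)} (D ∖ X)`
  (`DecisionTree.splice`) is injective on `𝒫(D)`, and `MTree.injOn_hybrid'` — the same for the complementary hybrid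
  `(D ∖ X) →_{S(X)} X` (`= C₁ →_S̄ C₂` up to complement);
* `MTree.ofDTree`, `kept_ofDTree` — the all-`S` trees of `DecisionTreeBK` are the special case `keep ≡ true`
  (`kept (ofDTree T) = revealed T`).
Design note.  In the all-`S` case the hybrid map is an involution because `revealed` is self-determined
(`TreeCount`-style proofs); with `S̄`-nodes `kept` is NOT self-determined (the coordinate of an `S̄`-node is complemented
in the hybrid, which therefore follows another path of the tree) and the hybrid map is a bijection but not an
involution.  The proof is the induction on the tree of the printed argument: the root's decision makes the hybrid's root
coordinate a fixed (identity or complement) function of the configuration's, so two configurations with the same hybrid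
take the same branch.  Not here: trees reading both configurations (four-way branching), the weighted (`p ≠ 1/2`,
general `C₂`) statement of Lemma 3.1 for these trees, Main Lemma 8.1.
-/

namespace Literature.Probability.Percolation

/-- **Decision trees with decisions** (Def. 2.4): a `leaf` stops; `node e keep yes no` queries the coordinate `e` of the
(first) configuration, sends it to `S` if `keep = true` and to `S̄` if `keep = false`, and continues with `yes` if `e` is
open and with `no` otherwise. [cite: Gladkov2024, Def. 2.4] -/
inductive MTree (ι : Type*) : Type _
  | leaf : MTree ι
  | node : ι → Bool → MTree ι → MTree ι → MTree ι

namespace MTree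

open Finset DecisionTree

variable {ι : Type*} [DecidableEq ι]

/-- The set `S(C₁)` built by the tree on the configuration `C₁ = X` (Algorithm 1): the coordinates queried along the
path followed by `X` at the nodes whose decision is "`S`". [cite: Gladkov2024, Def. 2.4 and Algorithm 1] -/
def kept : MTree ι → Finset ι → Finset ι
  | .leaf, _ => ∅
  | .node e k yes no, X => (if k then {e} else ∅) ∪ (if e ∈ X then kept yes X else kept no X)

/-- The set of coordinates queried (revealed) along the path followed by `X`, whatever the decisions.
[cite: Gladkov2024, Def. 2.4 and Algorithm 1] -/
def read : MTree ι → Finset ι → Finset ι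
  | .leaf, _ => ∅
  | .node e _ yes no, X => insert e (if e ∈ X then read yes X else read no X)

/-- Validity relative to a set `seen` of already-queried coordinates: every node queries a coordinate outside `seen`,
and its subtrees are valid relative to `seen` enlarged by that coordinate — i.e. "the nodes on every path query pairwise
distinct edges", none of them in `seen`. [cite: Gladkov2024, Def. 2.4] -/
def ValidOn : MTree ι → Finset ι → Prop
  | .leaf, _ => True
  | .node e _ yes no, seen => e ∉ seen ∧ ValidOn yes (insert e seen) ∧ ValidOn no (insert e seen)

/-- The all-`S` trees of `DecisionTreeBK` as decision trees with decisions (`keep ≡ true`). [cite: Gladkov2024, Def. 2.4] -/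
def ofDTree : DTree ι → MTree ι
  | .leaf => .leaf
  | .node e yes no => .node e true (ofDTree yes) (ofDTree no)

/-- For an all-`S` tree the set built is the revealed set of `DecisionTreeBK`. [cite: Gladkov2024, Def. 2.4] -/
theorem kept_ofDTree : ∀ (T : DTree ι) (X : Finset ι), kept (ofDTree T) X = DecisionTree.revealed T X
  | .leaf, _ => rfl
  | .node e yes no, X => by
      simp only [ofDTree, kept, DecisionTree.revealed, ↓reduceIte, kept_ofDTree yes, kept_ofDTree no]
      split_ifs <;> rw [Finset.insert_eq]

/-- The set built is contained in the set read. [cite: Gladkov2024, Def. 2.4] -/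
theorem kept_subset_read : ∀ (T : MTree ι) (X : Finset ι), kept T X ⊆ read T X
  | .leaf, _ => by simp [kept, read]
  | .node e k yes no, X => by
      intro i hi
      simp only [kept, Finset.mem_union] at hi
      simp only [read, Finset.mem_insert]
      rcases hi with hi | hi
      · split_ifs at hi with hk
        · exact Or.inl (Finset.mem_singleton.1 hi)
        · simp at hi
      · right
        split_ifs at hi ⊢ with he
        · exact kept_subset_read yes X hi
        · exact kept_subset_read no X hi

/-- A valid tree never reads a coordinate of `seen`. [cite: Gladkov2024, Def. 2.4] -/
theorem not_mem_read_of_mem : ∀ (T : MTree ι) {seen : Finset ι}, ValidOn T seen →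
    ∀ {i : ι}, i ∈ seen → ∀ X : Finset ι, i ∉ read T X
  | .leaf, _, _, _, _, _ => by simp [read]
  | .node e k yes no, seen, hV, i, hi, X => by
      obtain ⟨he, hyes, hno⟩ := hV
      simp only [read, Finset.mem_insert, not_or]
      refine ⟨fun h => he (h ▸ hi), ?_⟩
      split_ifs with hX
      · exact not_mem_read_of_mem yes hyes (Finset.mem_insert_of_mem hi) X
      · exact not_mem_read_of_mem no hno (Finset.mem_insert_of_mem hi) X

/-- A valid tree never puts a coordinate of `seen` into the set it builds. [cite: Gladkov2024, Def. 2.4] -/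
theorem not_mem_kept_of_mem (T : MTree ι) {seen : Finset ι} (hV : ValidOn T seen) {i : ι} (hi : i ∈ seen)
    (X : Finset ι) : i ∉ kept T X :=
  fun h => not_mem_read_of_mem T hV hi X (kept_subset_read T X h)

/-- Validity is monotone in `seen`. [cite: Gladkov2024, Def. 2.4] -/
theorem validOn_mono : ∀ (T : MTree ι) {seen seen' : Finset ι}, seen' ⊆ seen → ValidOn T seen → ValidOn T seen'
  | .leaf, _, _, _, _ => trivial
  | .node e k yes no, seen, seen', hs, hV => by
      obtain ⟨he, hyes, hno⟩ := hV
      exact ⟨fun h => he (hs h), validOn_mono yes (Finset.insert_subset_insert e hs) hyes,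
        validOn_mono no (Finset.insert_subset_insert e hs) hno⟩

/-- Splicing along the empty set returns the second configuration (`C₁ →_∅ C₂ = C₂`). [cite: Gladkov2024, Def. 2.3] -/
theorem splice_empty (S₁ S₂ : Finset ι) : splice ∅ S₁ S₂ = S₂ := by
  ext i
  rw [mem_splice_of_not_mem (Finset.notMem_empty i)]

/-- The root coordinate of the hybrid: at a node `(e, keep)`, `e ∈ X →_{S(X)} (D ∖ X)` iff `e ∈ X` (decision `S`) resp. iff
`e ∈ D ∖ X` (decision `S̄`), for a tree valid on `seen`. [cite: Gladkov2024, Lemma 3.1 (proof)] -/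
theorem mem_hybrid_root {e : ι} {k : Bool} {yes no : MTree ι} {seen : Finset ι}
    (hV : ValidOn (.node e k yes no) seen) (D X : Finset ι) :
    e ∈ splice (kept (.node e k yes no) X) X (D \ X) ↔ (if k then e ∈ X else e ∈ D \ X) := by
  obtain ⟨-, hyes, hno⟩ := hV
  have hchild : e ∉ (if e ∈ X then kept yes X else kept no X) := by
    split_ifs
    · exact not_mem_kept_of_mem yes hyes (Finset.mem_insert_self e seen) X
    · exact not_mem_kept_of_mem no hno (Finset.mem_insert_self e seen) X
  cases k
  · have hF : e ∉ kept (.node e false yes no) X := by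
      simp only [kept, Bool.false_eq_true, ↓reduceIte, Finset.empty_union]
      exact hchild
    rw [mem_splice_of_not_mem hF]
    simp
  · have hF : e ∈ kept (.node e true yes no) X := by
      simp only [kept, ↓reduceIte, Finset.mem_union, Finset.mem_singleton, true_or]
    rw [mem_splice_of_mem hF]
    simp

/-- Off the root coordinate the hybrid of a node is the hybrid of the branch taken. [cite: Gladkov2024, Lemma 3.1 (proof)] -/
theorem mem_hybrid_of_ne {e i : ι} (hie : i ≠ e) (k : Bool) (yes no : MTree ι) (D X : Finset ι) :
    i ∈ splice (kept (.node e k yes no) X) X (D \ X) ↔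
      i ∈ splice (kept (if e ∈ X then yes else no) X) X (D \ X) := by
  have hki : i ∉ (if k then ({e} : Finset ι) else ∅) := by
    split_ifs
    · simpa using hie
    · simp
  have hmem : i ∈ kept (.node e k yes no) X ↔ i ∈ kept (if e ∈ X then yes else no) X := by
    simp only [kept, Finset.mem_union]
    constructor
    · rintro (h | h)
      · exact absurd h hki
      · split_ifs at h ⊢ <;> exact h
    · intro h
      right
      split_ifs at h ⊢ <;> exact h
  rw [mem_splice, mem_splice, hmem]

/-- **Lemma 3.1, bijection form (side `S`).**  For a tree with decisions, valid on some `seen`, the hybrid map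
`X ↦ X →_{S(X)} (D ∖ X)` — keep `X` on the set built, complement it (inside `D`) elsewhere — is injective on `𝒫(D)`
(hence a bijection of the finite set `𝒫(D)`). [cite: Gladkov2024, Lemma 3.1] -/
theorem injOn_hybrid (D : Finset ι) : ∀ (T : MTree ι) (seen : Finset ι), ValidOn T seen →
    Set.InjOn (fun X => splice (kept T X) X (D \ X)) (↑D.powerset : Set (Finset ι))
  | .leaf, _, _ => by
      intro X hX X' hX' h
      rw [mem_coe, mem_powerset] at hX hX'
      simp only [kept, splice_empty] at h
      rw [← Finset.sdiff_sdiff_eq_self hX, h, Finset.sdiff_sdiff_eq_self hX']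
  | .node e k yes no, seen, hV => by
      intro X hX X' hX' h
      have hXD : X ⊆ D := by rw [mem_coe, mem_powerset] at hX; exact hX
      have hXD' : X' ⊆ D := by rw [mem_coe, mem_powerset] at hX'; exact hX'
      simp only at h
      -- the root coordinate: `e ∈ X ↔ e ∈ X'`
      have hroot : (if k then e ∈ X else e ∈ D \ X) ↔ (if k then e ∈ X' else e ∈ D \ X') := by
        rw [← mem_hybrid_root hV D X, ← mem_hybrid_root hV D X', h]
      have he : e ∈ X ↔ e ∈ X' := by
        cases k
        · simp only [Bool.false_eq_true, ↓reduceIte, Finset.mem_sdiff] at hroot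
          by_cases heD : e ∈ D
          · constructor
            · intro h1
              by_contra h2
              exact (hroot.2 ⟨heD, h2⟩).2 h1
            · intro h1
              by_contra h2
              exact (hroot.1 ⟨heD, h2⟩).2 h1
          · exact ⟨fun h1 => absurd (hXD h1) heD, fun h1 => absurd (hXD' h1) heD⟩
        · simpa using hroot
      -- both configurations take the same branch `c`, valid on `insert e seen`, and have the same `c`-hybrid
      obtain ⟨-, hyes, hno⟩ := hV
      have key : ∀ (c : MTree ι), ValidOn c (insert e seen) →
          (if e ∈ X then yes else no) = c → (if e ∈ X' then yes else no) = c →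
            splice (kept c X) X (D \ X) = splice (kept c X') X' (D \ X') := by
        intro c hc hcX hcX'
        ext i
        by_cases hie : i = e
        · subst hie
          have h1 : i ∉ kept c X := not_mem_kept_of_mem c hc (Finset.mem_insert_self i seen) X
          have h2 : i ∉ kept c X' := not_mem_kept_of_mem c hc (Finset.mem_insert_self i seen) X'
          rw [mem_splice_of_not_mem h1, mem_splice_of_not_mem h2, Finset.mem_sdiff, Finset.mem_sdiff, he]
        · have h1 := mem_hybrid_of_ne hie k yes no D X
          have h2 := mem_hybrid_of_ne hie k yes no D X'
          rw [hcX] at h1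
          rw [hcX'] at h2
          rw [← h1, ← h2, h]
      by_cases heX : e ∈ X
      · have heX' : e ∈ X' := he.1 heX
        exact injOn_hybrid D yes (insert e seen) hyes hX hX' (key yes hyes (if_pos heX) (if_pos heX'))
      · have heX' : e ∉ X' := fun h' => heX (he.2 h')
        exact injOn_hybrid D no (insert e seen) hno hX hX' (key no hno (if_neg heX) (if_neg heX'))

/-- The complement (inside `D`) of the hybrid `X →_F (D ∖ X)` is the opposite hybrid `(D ∖ X) →_F X`, for `X ⊆ D`
(the printed `C₂ →_S C₁ = C₁ →_S̄ C₂`, with `C₂ = D ∖ C₁`; the same statement as `TreeCount.sdiff_splice_compl` of the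
CriticalPhenomena Summits tree, restated here because Literature files cannot import Summits). [cite: Gladkov2024, Lemma 3.1] -/
theorem sdiff_hybrid {D F X : Finset ι} (hX : X ⊆ D) : D \ splice F X (D \ X) = splice F (D \ X) X := by
  ext i
  have hXD : i ∈ X → i ∈ D := fun h => hX h
  rw [mem_sdiff, mem_splice, mem_splice, mem_sdiff]
  tauto

/-- **Lemma 3.1, bijection form (side `S̄`).**  For a valid tree with decisions, the complementary hybrid map
`X ↦ (D ∖ X) →_{S(X)} X` (complement on the set built, `X` elsewhere; `= C₁ →_S̄ C₂` of the printed lemma with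
`C₂ = D ∖ C₁`) is injective on `𝒫(D)`. [cite: Gladkov2024, Lemma 3.1] -/
theorem injOn_hybrid' (D : Finset ι) (T : MTree ι) (seen : Finset ι) (hV : ValidOn T seen) :
    Set.InjOn (fun X => splice (kept T X) (D \ X) X) (↑D.powerset : Set (Finset ι)) := by
  intro X hX X' hX' h
  have hXD : X ⊆ D := by rw [mem_coe, mem_powerset] at hX; exact hX
  have hXD' : X' ⊆ D := by rw [mem_coe, mem_powerset] at hX'; exact hX'
  refine injOn_hybrid D T seen hV hX hX' ?_
  simp only at h ⊢
  have e1 : splice (kept T X) X (D \ X) = D \ splice (kept T X) (D \ X) X := by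
    rw [← sdiff_hybrid hXD, Finset.sdiff_sdiff_eq_self (splice_subset hXD sdiff_subset)]
  have e2 : splice (kept T X') X' (D \ X') = D \ splice (kept T X') (D \ X') X' := by
    rw [← sdiff_hybrid hXD', Finset.sdiff_sdiff_eq_self (splice_subset hXD' sdiff_subset)]
  rw [e1, e2, h]

/-- The hybrid `X →_{S(X)} (D ∖ X)` of a configuration `X ⊆ D` lies in `𝒫(D)`. [cite: Gladkov2024, Def. 2.3] -/
theorem hybrid_subset {D : Finset ι} (T : MTree ι) {X : Finset ι} (hX : X ⊆ D) :
    splice (kept T X) X (D \ X) ⊆ D :=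
  splice_subset hX sdiff_subset

/-- **Lemma 3.1, bijection form, as a statement about `𝒫(D)`**: for a valid tree with decisions the hybrid map is a
bijection of `𝒫(D)` onto itself. [cite: Gladkov2024, Lemma 3.1] -/
theorem bijOn_hybrid (D : Finset ι) (T : MTree ι) (seen : Finset ι) (hV : ValidOn T seen) :
    Set.BijOn (fun X => splice (kept T X) X (D \ X)) (↑D.powerset : Set (Finset ι)) (↑D.powerset : Set (Finset ι)) := by
  have hmaps : Set.MapsTo (fun X => splice (kept T X) X (D \ X)) (↑D.powerset : Set (Finset ι))
      (↑D.powerset : Set (Finset ι)) := by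
    intro X hX
    rw [mem_coe, mem_powerset] at hX ⊢
    exact hybrid_subset T hX
  have hinj := injOn_hybrid D T seen hV
  refine ⟨hmaps, hinj, ?_⟩
  -- surjectivity from injectivity on a finite set mapped into itself
  have hsurj : Set.SurjOn (fun X => splice (kept T X) X (D \ X)) (↑D.powerset : Set (Finset ι))
      (↑D.powerset : Set (Finset ι)) :=
    Finset.surjOn_of_injOn_of_card_le _ (fun X hX => hmaps hX) hinj le_rfl
  exact hsurj

end MTree

end Literature.Probability.Percolation
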